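import Literature.Probability.LatticeModels.DisagreementPercolation
import Literature.MathematicalPhysics.QuantumFieldTheory.AdhikariCao2022.SwappingLemma
import Mathlib.MeasureTheory.Function.FactorsThrough
import HarnessLib

/-!
# Disagreement percolation: [GHM01] Prop. 7.10 and Cor. 7.11, PROVED

Companion («Proofs») file of `DisagreementPercolation.lean` (same directory and namespace).  It DISCHARGES
the named facts `GHM2001_disagreementCovarianceBound` ([GHM01] = Georgii–Häggström–Maes 2001, Corollary
7.11 p0045 L63–73: for a Markov specification with finite spin space, a finite volume `Λ`, a boundary
condition `η` and local `f`, `g` depending on the spins in `Δ, Δ′ ⊆ Λ`,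
`|γ_Λ^η(f;g)| ≤ δ(f) δ(g) (γ_Λ^η ⊗ γ_Λ^η)(Δ ↔≠ Δ′ in Λ)`) as the theorem
`GHM2001_disagreementCovarianceBound_holds`, and `GHM2001_productCouplingBound` ([GHM01] Proposition 7.10
p0045 L25–31, van den Berg's forerunner [vdB93] of the disagreement coupling: for `Δ ⊆ Λ`, boundary
conditions `η, η′` and a `Δ`-local event `A`, `|γ_Λ(A|η) − γ_Λ(A|η′)| ≤ (γ_Λ^η ⊗ γ_Λ^{η′})(Δ ↔≠ ∂Λ)`) as
`GHM2001_productCouplingBound_holds` (section `TwoBoundaryConditions` at the end).  No new definition of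
mathematical content, no new fact (net debt −2); the definitions below are proof bookkeeping (fibres of the
restriction to `Λ`, the exchange maps).

## The proof (van den Berg's exchange argument, [vdB93] proof of Thm 1 p.163; [GHM01] proof of Prop. 7.10)

Work with two independent copies `(ξ, ξ′)` of `γ_Λ^η`.  Let `K = K(ξ, ξ′) ⊆ Λ` be the set of vertices of `Λ`
joined to `Δ′` by a path of disagreement inside `Λ` (the disagreement clusters meeting `Δ′`), and let `T`
EXCHANGE `ξ` and `ξ′` on `K`.  Then: (a) `T` does not change the disagreement set, hence not `K`, so `T`
is an involution (`exch_exch`); (b) on the complement of `{Δ ↔≠ Δ′ in Λ}` the region `K` misses `Δ`, so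
`f(Tξ) = f(ξ)`, while `g(Tξ) = g(ξ′)` (`Δ′`-sites either lie in `K` or agree); (c) THE WEIGHT IS INVARIANT,
`γ_Λ^η(ξ̃) γ_Λ^η(ξ̃′) = γ_Λ^η(ξ) γ_Λ^η(ξ′)` (`weight_exch`): by CONSISTENCY `γ_Λ = γ_Λ γ_K` and
properness, the weight of the cylinder of `ξ` factorises as `γ_K(ξ_K | ξ) · γ_Λ^η(ξ off K)`
(`weight_factor`; the first factor reads `ξ` only off `K` by `𝓕_{Kᶜ}`-measurability of the kernel —
Doob–Dynkin, `kernel_eq_of_agree_off`), and by the MARKOV property the `K`-factor reads `ξ` only on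
`∂K`, where `ξ ≡ ξ′` (a disagreeing `Λ`-neighbour of `K` would belong to `K`; off `Λ` both equal `η`).
(a)–(c) say that `T` is a SWAPPING MAP in the sense of Adhikari–Cao, Def. 3.1 — the tree's
`Literature.MathematicalPhysics.QuantumFieldTheory.AdhikariCao2022.IsSwappingMap` — for the finite
probability weight `ζ ↦ γ_Λ^η(σ ≡ ζ on Λ)` on `S^Λ`, the good event, and the centred functions
`f − (sup f + inf f)/2`, `g − (sup g + inf g)/2`; the tree's swapping lemma
`AdhikariCao2022.norm_fcov_le_of_isSwappingMap` (Adhikari–Cao Lemma 3.2, proved there) then gives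
`|Cov(f,g)| ≤ 2 · (δf/2)(δg/2) · P(bad) = ½ δ(f)δ(g) P(Δ ↔≠ Δ′ in Λ)`, better than printed by a factor 2.
The passage between `γ_Λ^η` on `S^V` and the finite weight on `S^Λ` is `integral_eq_sum_fiber` /
`prod_real_disagreementIn` (the `|S|^{|Λ|}` fibres of the restriction map partition `S^V`).

References: [GHM01] arXiv:math/9905031 §7.1, §7.3 [cite: GeorgiiHaggstromMaes2001]; [vdB93] J. van den
Berg, CMP 152 (1993) 161–166, proof of Thm 1 [cite: Vandenberg1993]; A. Adhikari, S. Cao, Ann. Probab. 53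
(2025), Def. 3.1 / Lemma 3.2 [cite: AdhikariCao2025] (tree: `AdhikariCao2022/SwappingLemma.lean`).
Typed by cell `ym-ir`, seat lit-3.  Nothing here concerns gauge theories or the Clay problem.
-/

open MeasureTheory Finset

noncomputable section

namespace Literature.Probability.LatticeModels

namespace DisagreementCovariance

universe u v

variable {V : Type u} {S : Type v} [MeasurableSpace S]

/-- The cylinder of configurations agreeing with `ξ` on the finite set `K`. [folklore] -/
def agreeOn (K : Finset V) (ξ : V → S) : Set (V → S) := {σ | ∀ x ∈ K, σ x = ξ x}

omit [MeasurableSpace S] in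
/-- Membership in a cylinder. [folklore] -/
private theorem mem_agreeOn {K : Finset V} {ξ σ : V → S} : σ ∈ agreeOn K ξ ↔ ∀ x ∈ K, σ x = ξ x := Iff.rfl

/-- Cylinders over finite sets are measurable (measurable singletons in `S`). [folklore] -/
private theorem measurableSet_agreeOn [MeasurableSingletonClass S] (K : Finset V) (ξ : V → S) :
    MeasurableSet (agreeOn K ξ) := by
  have : agreeOn K ξ = ⋂ x ∈ K, (fun σ : V → S => σ x) ⁻¹' {ξ x} := by
    ext σ; simp [agreeOn]
  rw [this]
  exact MeasurableSet.biInter K.countable_toSet fun x _ =>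
    measurable_pi_apply x (measurableSet_singleton (ξ x))

omit [MeasurableSpace S] in
/-- A cylinder over `K` is a `K`-local event. [folklore] -/
private theorem dependsOn_mem_agreeOn (K : Finset V) (ξ : V → S) : DependsOn (· ∈ agreeOn K ξ) (↑K : Set V) := by
  intro σ τ h
  simp only [mem_agreeOn, eq_iff_iff]
  exact ⟨fun hσ x hx => (h x (Finset.mem_coe.2 hx)).symm.trans (hσ x hx),
    fun hτ x hx => (h x (Finset.mem_coe.2 hx)).trans (hτ x hx)⟩

/-- Doob–Dynkin for specification kernels: `θ ↦ γ_K(A | θ)` reads `θ` only off `K`. [folklore] -/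
private theorem kernel_eq_of_agree_off {γ : Specification V S} (hγ : IsSpecification γ) (K : Finset V)
    {A : Set (V → S)} (hA : MeasurableSet A) {θ θ' : V → S} (h : ∀ x, x ∉ K → θ x = θ' x) :
    γ K θ A = γ K θ' A := by
  have hm : Measurable[cylinderEvents (X := fun _ : V => S) ((↑K : Set V)ᶜ)] fun η => γ K η A :=
    hγ.measurable K A hA
  have hle : cylinderEvents (X := fun _ : V => S) ((↑K : Set V)ᶜ) ≤
      MeasurableSpace.comap (Set.restrict ((↑K : Set V)ᶜ)) MeasurableSpace.pi := by
    refine iSup₂_le fun i hi => ?_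
    have : (fun σ : V → S => σ i) = (fun η : ((↑K : Set V)ᶜ : Set V) → S => η ⟨i, hi⟩) ∘
        Set.restrict ((↑K : Set V)ᶜ) := rfl
    rw [this, ← MeasurableSpace.comap_comp]
    exact MeasurableSpace.comap_mono (measurable_pi_apply _).comap_le
  have hdep : DependsOn (fun η => γ K η A) ((↑K : Set V)ᶜ) :=
    dependsOn_iff_factorsThrough.2 (hm.mono hle le_rfl).factorsThrough
  exact hdep fun x hx => h x (fun hxK => hx (Finset.mem_coe.2 hxK))

/-- **Factorisation of cylinder weights through a sub-volume.**  For `K ⊆ Λ` and a pattern `ξ` equal to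
the boundary condition `η` off `Λ`:
`γ_Λ(σ ≡ ξ on Λ | η) = γ_K(τ ≡ ξ on K | ξ) · γ_Λ(σ ≡ ξ on Λ ∖ K | η)` (consistency + properness). [cite: Vandenberg1993, Theorem 1 (proof: «sum over all possibilities for C_A … Markov property»)] -/
theorem weight_factor [MeasurableSingletonClass S] [DecidableEq V] {γ : Specification V S} (hγ : IsSpecification γ)
    {K Λ : Finset V} (hK : K ⊆ Λ) {η ξ : V → S} (hξ : ∀ x, x ∉ Λ → ξ x = η x) :
    γ Λ η (agreeOn Λ ξ) = γ K ξ (agreeOn K ξ) * γ Λ η (agreeOn (Λ \ K) ξ) := by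
  classical
  have hA := measurableSet_agreeOn (S := S) Λ ξ
  rw [← hγ.consistent hK η _ hA]
  have hprop := hγ.proper Λ η
  have hae : ∀ᵐ σ ∂(γ Λ η), γ K σ (agreeOn Λ ξ) =
      (agreeOn (Λ \ K) ξ).indicator (fun _ => γ K ξ (agreeOn K ξ)) σ := by
    filter_upwards [hprop] with σ hσ
    by_cases hcase : σ ∈ agreeOn (Λ \ K) ξ
    · rw [Set.indicator_of_mem hcase]
      -- `A_Λ =ᵐ[γ_K(·|σ)] A_K`, then Doob–Dynkin
      have h1 : γ K σ (agreeOn Λ ξ) = γ K σ (agreeOn K ξ) := by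
        refine measure_congr ?_
        filter_upwards [hγ.proper K σ] with τ hτ
        refine propext ⟨fun h x hx => h x (hK hx), fun h x hx => ?_⟩
        by_cases hxK : x ∈ K
        · exact h x hxK
        · rw [hτ x hxK]; exact (mem_agreeOn.1 hcase) x (Finset.mem_sdiff.2 ⟨hx, hxK⟩)
      rw [h1]
      refine kernel_eq_of_agree_off hγ K (measurableSet_agreeOn K ξ) fun x hxK => ?_
      by_cases hxΛ : x ∈ Λ
      · exact (mem_agreeOn.1 hcase) x (Finset.mem_sdiff.2 ⟨hxΛ, hxK⟩)
      · rw [hσ x hxΛ, hξ x hxΛ]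
    · rw [Set.indicator_of_notMem hcase]
      -- `A_Λ =ᵐ[γ_K(·|σ)] ∅`
      obtain ⟨x, hx, hne⟩ : ∃ x ∈ Λ \ K, σ x ≠ ξ x := by
        by_contra hcon
        exact hcase fun x hx => Classical.byContradiction fun hne => hcon ⟨x, hx, hne⟩
      refine measure_mono_null (t := {τ | ¬ (∀ y, y ∉ K → τ y = σ y)}) ?_ ?_
      · intro τ hτ hall
        have hxK : x ∉ K := (Finset.mem_sdiff.1 hx).2
        exact hne ((hall x hxK).symm.trans (hτ x (Finset.mem_sdiff.1 hx).1))
      · exact (ae_iff.1 (hγ.proper K σ))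
  rw [lintegral_congr_ae hae, lintegral_indicator_const (measurableSet_agreeOn _ _)]


/-! ### Fibres over the restriction to `Λ` -/

section Fibres

variable (Λ : Finset V) (η : V → S)

/-- The fibre of the restriction map over `ζ : Λ → S`: configurations equal to `ζ` on `Λ`. [folklore] -/
def fiber (ζ : ↥Λ → S) : Set (V → S) := agreeOn Λ (glueWith Λ ζ η)

omit [MeasurableSpace S] in
/-- Membership in a fibre. [folklore] -/
private theorem mem_fiber {ζ : ↥Λ → S} {σ : V → S} : σ ∈ fiber Λ η ζ ↔ ∀ x (hx : x ∈ Λ), σ x = ζ ⟨x, hx⟩ := by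
  simp only [fiber, mem_agreeOn]
  refine forall_congr' fun x => forall_congr' fun hx => ?_
  rw [glueWith_apply_mem Λ ζ η hx]

omit [MeasurableSpace S] in
/-- Every configuration lies in the fibre of its own restriction. [folklore] -/
private theorem mem_fiber_restrict (σ : V → S) : σ ∈ fiber Λ η (fun x : ↥Λ => σ x) :=
  (mem_fiber Λ η).2 fun _ _ => rfl

omit [MeasurableSpace S] in
/-- Fibres over different `Λ`-configurations are disjoint. [folklore] -/
private theorem eq_of_mem_fiber {ζ ζ' : ↥Λ → S} {σ : V → S} (h : σ ∈ fiber Λ η ζ) (h' : σ ∈ fiber Λ η ζ') :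
    ζ = ζ' := by
  funext x
  exact (((mem_fiber Λ η).1 h) x x.2).symm.trans (((mem_fiber Λ η).1 h') x x.2)

/-- Fibres are measurable. [folklore] -/
private theorem measurableSet_fiber [MeasurableSingletonClass S] (ζ : ↥Λ → S) : MeasurableSet (fiber Λ η ζ) := measurableSet_agreeOn _ _

omit [MeasurableSpace S] in
/-- The fibres are pairwise disjoint. [folklore] -/
private theorem pairwiseDisjoint_fiber : Pairwise fun ζ ζ' : ↥Λ → S => Disjoint (fiber Λ η ζ) (fiber Λ η ζ') := by
  intro ζ ζ' hne
  rw [Set.disjoint_left]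
  intro σ h h'
  exact hne (eq_of_mem_fiber Λ η h h')

omit [MeasurableSpace S] in
/-- The fibres cover the configuration space. [folklore] -/
private theorem iUnion_fiber : (⋃ ζ : ↥Λ → S, fiber Λ η ζ) = Set.univ :=
  Set.eq_univ_of_forall fun σ => Set.mem_iUnion.2 ⟨_, mem_fiber_restrict Λ η σ⟩

omit [MeasurableSpace S] in
/-- A `Λ`-local function is constant on fibres: `F σ = F (glue (σ|Λ) η)`. [folklore] -/
private theorem apply_eq_apply_glue {F : (V → S) → ℝ} (hF : DependsOn F (↑Λ : Set V)) {ζ : ↥Λ → S} {σ : V → S}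
    (h : σ ∈ fiber Λ η ζ) : F σ = F (glueWith Λ ζ η) :=
  hF fun x hx => by rw [glueWith_apply_mem Λ ζ η (Finset.mem_coe.1 hx)]; exact (mem_fiber Λ η).1 h x _

/-- Integrals of `Λ`-local functions against a probability measure on `S^V` are finite sums over the
`|S|^|Λ|` fibres. [folklore] -/
private theorem integral_eq_sum_fiber [MeasurableSingletonClass S] [Fintype (↥Λ → S)] (μ : Measure (V → S))
    [IsFiniteMeasure μ]
    {F : (V → S) → ℝ} (hF : DependsOn F (↑Λ : Set V)) :
    ∫ σ, F σ ∂μ = ∑ ζ : ↥Λ → S, μ.real (fiber Λ η ζ) * F (glueWith Λ ζ η) := by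
  classical
  have hpt : ∀ σ, F σ = ∑ ζ : ↥Λ → S, (fiber Λ η ζ).indicator (fun _ => F (glueWith Λ ζ η)) σ := by
    intro σ
    rw [Finset.sum_eq_single (fun x : ↥Λ => σ x)]
    · rw [Set.indicator_of_mem (mem_fiber_restrict Λ η σ)]
      exact apply_eq_apply_glue Λ η hF (mem_fiber_restrict Λ η σ)
    · intro ζ _ hne
      rw [Set.indicator_of_notMem]
      intro h
      exact hne (eq_of_mem_fiber Λ η h (mem_fiber_restrict Λ η σ))
    · intro h; exact absurd (Finset.mem_univ _) h
  rw [integral_congr_ae (Filter.Eventually.of_forall hpt), integral_finsetSum]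
  · refine Finset.sum_congr rfl fun ζ _ => ?_
    rw [integral_indicator_const _ (measurableSet_fiber Λ η ζ), smul_eq_mul]
  · intro ζ _
    exact (integrable_const _).indicator (measurableSet_fiber Λ η ζ)

/-- The fibre weights of a probability measure sum to one. [folklore] -/
private theorem sum_real_fiber [MeasurableSingletonClass S] [Fintype (↥Λ → S)] (μ : Measure (V → S))
    [IsProbabilityMeasure μ] :
    ∑ ζ : ↥Λ → S, μ.real (fiber Λ η ζ) = 1 := by
  rw [← measureReal_biUnion_finset (fun ζ _ ζ' _ h => pairwiseDisjoint_fiber Λ η h)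
    (fun ζ _ => measurableSet_fiber Λ η ζ)]
  simp only [Finset.mem_univ, Set.iUnion_true, iUnion_fiber]
  exact probReal_univ

end Fibres

/-! ### The exchange map on pairs of `Λ`-configurations -/

section Exchange

variable (G : SimpleGraph V) (Λ Δ' : Finset V) (η : V → S)

/-- Disagreement of a pair of `Λ`-configurations at a vertex (both extended by `η` off `Λ`). [cite: GeorgiiHaggstromMaes2001, §7.1] -/
def Dis (p : (↥Λ → S) × (↥Λ → S)) (v : V) : Prop := glueWith Λ p.1 η v ≠ glueWith Λ p.2 η v

/-- `v` is joined to `Δ′` by a path of disagreement inside `Λ`. [cite: GeorgiiHaggstromMaes2001, Corollary 7.11] -/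
def Conn (p : (↥Λ → S) × (↥Λ → S)) (v : V) : Prop :=
  ∃ y ∈ Δ', ∃ w : G.Walk v y, ∀ u ∈ w.support, u ∈ Λ ∧ Dis Λ η p u

/-- The exchange region: the disagreement clusters inside `Λ` that meet `Δ′`. [cite: Vandenberg1993, Theorem 1 (proof, the cluster C_A)] -/
def region (p : (↥Λ → S) × (↥Λ → S)) : Finset V := by
  classical exact Λ.filter (Conn G Λ Δ' η p)

/-- The exchange map: swap the two configurations on the exchange region. [cite: Vandenberg1993, Theorem 1 (proof, the transformation T)] -/
def exch (p : (↥Λ → S) × (↥Λ → S)) : (↥Λ → S) × (↥Λ → S) := by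
  classical exact
  (fun x => if (x : V) ∈ region G Λ Δ' η p then p.2 x else p.1 x,
   fun x => if (x : V) ∈ region G Λ Δ' η p then p.1 x else p.2 x)

variable {G Λ Δ' η}

omit [MeasurableSpace S] in
/-- Membership in the exchange region. [cite: Vandenberg1993, Theorem 1 (proof)] -/
theorem mem_region {p : (↥Λ → S) × (↥Λ → S)} {v : V} :
    v ∈ region G Λ Δ' η p ↔ v ∈ Λ ∧ Conn G Λ Δ' η p v := by
  classical
  unfold region; rw [Finset.mem_filter]

omit [MeasurableSpace S] in
/-- Inside `Λ` disagreement is disagreement of the `Λ`-configurations. [folklore] -/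
private theorem dis_iff_of_mem {p : (↥Λ → S) × (↥Λ → S)} {v : V} (hv : v ∈ Λ) :
    Dis Λ η p v ↔ p.1 ⟨v, hv⟩ ≠ p.2 ⟨v, hv⟩ := by
  unfold Dis; rw [glueWith_apply_mem Λ p.1 η hv, glueWith_apply_mem Λ p.2 η hv]

omit [MeasurableSpace S] in
/-- Off `Λ` both copies equal `η`: no disagreement. [folklore] -/
private theorem not_dis_of_not_mem {p : (↥Λ → S) × (↥Λ → S)} {v : V} (hv : v ∉ Λ) : ¬ Dis Λ η p v := by
  unfold Dis; rw [glueWith_apply_not_mem Λ p.1 η hv, glueWith_apply_not_mem Λ p.2 η hv]; exact fun h => h rfl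

omit [MeasurableSpace S] in
/-- The exchange does not change the disagreement set. [cite: Vandenberg1993, Theorem 1 (proof)] -/
theorem dis_exch (p : (↥Λ → S) × (↥Λ → S)) (v : V) :
    Dis Λ η (exch G Λ Δ' η p) v ↔ Dis Λ η p v := by
  classical
  by_cases hv : v ∈ Λ
  · rw [dis_iff_of_mem hv, dis_iff_of_mem hv]
    simp only [exch]
    by_cases hK : v ∈ region G Λ Δ' η p
    · simp only [hK, if_true]; exact ne_comm
    · simp only [hK, if_false]
  · simp [not_dis_of_not_mem hv]

omit [MeasurableSpace S] in
/-- The exchange does not change the disagreement clusters. [cite: Vandenberg1993, Theorem 1 (proof)] -/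
theorem conn_exch (p : (↥Λ → S) × (↥Λ → S)) (v : V) :
    Conn G Λ Δ' η (exch G Λ Δ' η p) v ↔ Conn G Λ Δ' η p v := by
  unfold Conn
  simp only [dis_exch]

omit [MeasurableSpace S] in
/-- The exchange does not change the exchange region. [cite: Vandenberg1993, Theorem 1 (proof)] -/
theorem region_exch (p : (↥Λ → S) × (↥Λ → S)) :
    region G Λ Δ' η (exch G Λ Δ' η p) = region G Λ Δ' η p := by
  ext v; rw [mem_region, mem_region, conn_exch]

omit [MeasurableSpace S] in
/-- The exchange map is an involution. [cite: Vandenberg1993, Theorem 1 (proof): «This transformation is obviously 1-1»] -/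
theorem exch_exch (p : (↥Λ → S) × (↥Λ → S)) : exch G Λ Δ' η (exch G Λ Δ' η p) = p := by
  classical
  have hK := region_exch (G := G) (Λ := Λ) (Δ' := Δ') (η := η) p
  -- unfold the outer `exch` using `hK`, then the inner one pointwise
  have h1 : (exch G Λ Δ' η (exch G Λ Δ' η p)).1 = p.1 := by
    funext x
    show (if (x : V) ∈ region G Λ Δ' η (exch G Λ Δ' η p) then (exch G Λ Δ' η p).2 x
      else (exch G Λ Δ' η p).1 x) = p.1 x
    rw [hK]
    by_cases hx : (x : V) ∈ region G Λ Δ' η p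
    · rw [if_pos hx]; show (if (x : V) ∈ region G Λ Δ' η p then p.1 x else p.2 x) = p.1 x
      rw [if_pos hx]
    · rw [if_neg hx]; show (if (x : V) ∈ region G Λ Δ' η p then p.2 x else p.1 x) = p.1 x
      rw [if_neg hx]
  have h2 : (exch G Λ Δ' η (exch G Λ Δ' η p)).2 = p.2 := by
    funext x
    show (if (x : V) ∈ region G Λ Δ' η (exch G Λ Δ' η p) then (exch G Λ Δ' η p).1 x
      else (exch G Λ Δ' η p).2 x) = p.2 x
    rw [hK]
    by_cases hx : (x : V) ∈ region G Λ Δ' η p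
    · rw [if_pos hx]; show (if (x : V) ∈ region G Λ Δ' η p then p.2 x else p.1 x) = p.2 x
      rw [if_pos hx]
    · rw [if_neg hx]; show (if (x : V) ∈ region G Λ Δ' η p then p.1 x else p.2 x) = p.2 x
      rw [if_neg hx]
  exact Prod.ext h1 h2

omit [MeasurableSpace S] in
/-- A `Λ`-vertex outside the exchange region adjacent to it carries no disagreement. [cite: Vandenberg1993, Theorem 1 (proof)] -/
theorem not_dis_of_adj_region {p : (↥Λ → S) × (↥Λ → S)} {x y : V} (hx : x ∈ region G Λ Δ' η p)
    (hy : y ∉ region G Λ Δ' η p) (hyΛ : y ∈ Λ) (hadj : G.Adj y x) : ¬ Dis Λ η p y := by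
  intro hdis
  obtain ⟨-, z, hz, w, hw⟩ := mem_region.1 hx
  exact hy (mem_region.2 ⟨hyΛ, z, hz, SimpleGraph.Walk.cons hadj w, fun u hu => by
    rw [SimpleGraph.Walk.support_cons, List.mem_cons] at hu
    rcases hu with rfl | hu
    · exact ⟨hyΛ, hdis⟩
    · exact hw u hu⟩)

omit [MeasurableSpace S] in
/-- A disagreeing vertex of `Δ′` (inside `Λ`) lies in the exchange region. [cite: Vandenberg1993, Theorem 1 (proof)] -/
theorem mem_region_of_dis {p : (↥Λ → S) × (↥Λ → S)} {y : V} (hy : y ∈ Δ') (hyΛ : y ∈ Λ)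
    (hdis : Dis Λ η p y) : y ∈ region G Λ Δ' η p :=
  mem_region.2 ⟨hyΛ, y, hy, SimpleGraph.Walk.nil, fun u hu => by
    rw [SimpleGraph.Walk.support_nil, List.mem_singleton] at hu; subst hu; exact ⟨hyΛ, hdis⟩⟩

end Exchange


/-! ### Weight invariance of the exchange (consistency + Markov property) -/

section Weights

variable [MeasurableSingletonClass S] [DecidableEq V] {G : SimpleGraph V} [G.LocallyFinite]
  {γ : Specification V S} {Λ Δ Δ' : Finset V} {η : V → S}

omit [MeasurableSpace S] [MeasurableSingletonClass S] [G.LocallyFinite] in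
/-- First component of the exchange, pointwise. [folklore] -/
private theorem exch_fst_apply {p : (↥Λ → S) × (↥Λ → S)} (x : ↥Λ) :
    (exch G Λ Δ' η p).1 x = if (x : V) ∈ region G Λ Δ' η p then p.2 x else p.1 x := by
  unfold exch; dsimp only; split_ifs <;> rfl

omit [MeasurableSpace S] [MeasurableSingletonClass S] [G.LocallyFinite] in
/-- Second component of the exchange, pointwise. [folklore] -/
private theorem exch_snd_apply {p : (↥Λ → S) × (↥Λ → S)} (x : ↥Λ) :
    (exch G Λ Δ' η p).2 x = if (x : V) ∈ region G Λ Δ' η p then p.1 x else p.2 x := by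
  unfold exch; dsimp only; split_ifs <;> rfl

omit [MeasurableSpace S] [MeasurableSingletonClass S] [DecidableEq V] [G.LocallyFinite] in
/-- Cylinders on `K` (resp. `Λ ∖ K`-type sets) only read the pattern there. [folklore] -/
private theorem agreeOn_congr {K : Finset V} {ξ ξ' : V → S} (h : ∀ x ∈ K, ξ x = ξ' x) :
    agreeOn K ξ = agreeOn (S := S) K ξ' := by
  ext σ; simp only [mem_agreeOn]
  exact ⟨fun hσ x hx => (hσ x hx).trans (h x hx), fun hσ x hx => (hσ x hx).trans (h x hx).symm⟩

/-- **The exchange preserves the product weight** `γ_Λ(fibre ζ₁ | η) γ_Λ(fibre ζ₂ | η)`. [cite: Vandenberg1993, Theorem 1 (proof: «T is also measure preserving»)] -/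
theorem weight_exch (hγ : IsSpecification γ) (hM : γ.IsMarkov G) (p : (↥Λ → S) × (↥Λ → S)) :
    γ Λ η (fiber Λ η (exch G Λ Δ' η p).1) * γ Λ η (fiber Λ η (exch G Λ Δ' η p).2) =
      γ Λ η (fiber Λ η p.1) * γ Λ η (fiber Λ η p.2) := by
  classical
  set K := region G Λ Δ' η p with hKdef
  have hK : K ⊆ Λ := fun v hv => (mem_region.1 hv).1
  have hoff : ∀ (ζ : ↥Λ → S) (x : V), x ∉ Λ → glueWith Λ ζ η x = η x :=
    fun ζ x hx => glueWith_apply_not_mem Λ ζ η hx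
  -- factorise all four weights through `K`
  have fac : ∀ ζ : ↥Λ → S, γ Λ η (fiber Λ η ζ) =
      γ K (glueWith Λ ζ η) (agreeOn K (glueWith Λ ζ η)) *
        γ Λ η (agreeOn (Λ \ K) (glueWith Λ ζ η)) :=
    fun ζ => weight_factor hγ hK (hoff ζ)
  -- values of the exchanged configurations
  have e1K : ∀ x ∈ K, glueWith Λ (exch G Λ Δ' η p).1 η x = glueWith Λ p.2 η x := by
    intro x hx
    rw [glueWith_apply_mem Λ _ η (hK hx), glueWith_apply_mem Λ _ η (hK hx), exch_fst_apply, if_pos hx]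
  have e2K : ∀ x ∈ K, glueWith Λ (exch G Λ Δ' η p).2 η x = glueWith Λ p.1 η x := by
    intro x hx
    rw [glueWith_apply_mem Λ _ η (hK hx), glueWith_apply_mem Λ _ η (hK hx), exch_snd_apply, if_pos hx]
  have e1off : ∀ x, x ∉ K → glueWith Λ (exch G Λ Δ' η p).1 η x = glueWith Λ p.1 η x := by
    intro x hx
    by_cases hxΛ : x ∈ Λ
    · rw [glueWith_apply_mem Λ _ η hxΛ, glueWith_apply_mem Λ _ η hxΛ, exch_fst_apply, if_neg hx]
    · rw [hoff _ x hxΛ, hoff _ x hxΛ]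
  have e2off : ∀ x, x ∉ K → glueWith Λ (exch G Λ Δ' η p).2 η x = glueWith Λ p.2 η x := by
    intro x hx
    by_cases hxΛ : x ∈ Λ
    · rw [glueWith_apply_mem Λ _ η hxΛ, glueWith_apply_mem Λ _ η hxΛ, exch_snd_apply, if_neg hx]
    · rw [hoff _ x hxΛ, hoff _ x hxΛ]
  -- the boundary of `K` carries no disagreement
  have bdry : ∀ y ∈ outerBoundary G K, glueWith Λ p.1 η y = glueWith Λ p.2 η y := by
    intro y hy
    obtain ⟨hyK, x, hx, hadj⟩ := mem_outerBoundary_iff.1 hy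
    by_cases hyΛ : y ∈ Λ
    · have hnd := not_dis_of_adj_region (G := G) (Δ' := Δ') (η := η) hx hyK hyΛ hadj
      by_contra hne
      exact hnd hne
    · rw [hoff _ y hyΛ, hoff _ y hyΛ]
  -- the `K`-factors are exchanged (Markov property), the `Λ ∖ K`-factors are unchanged
  have q1 : γ K (glueWith Λ (exch G Λ Δ' η p).1 η) (agreeOn K (glueWith Λ (exch G Λ Δ' η p).1 η)) =
      γ K (glueWith Λ p.2 η) (agreeOn K (glueWith Λ p.2 η)) := by
    rw [agreeOn_congr e1K]
    refine hM K _ _ (fun y hy => ?_) _ (measurableSet_agreeOn K _) (dependsOn_mem_agreeOn K _)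
    rw [e1off y (mem_outerBoundary_iff.1 hy).1]
    exact bdry y hy
  have q2 : γ K (glueWith Λ (exch G Λ Δ' η p).2 η) (agreeOn K (glueWith Λ (exch G Λ Δ' η p).2 η)) =
      γ K (glueWith Λ p.1 η) (agreeOn K (glueWith Λ p.1 η)) := by
    rw [agreeOn_congr e2K]
    refine hM K _ _ (fun y hy => ?_) _ (measurableSet_agreeOn K _) (dependsOn_mem_agreeOn K _)
    rw [e2off y (mem_outerBoundary_iff.1 hy).1]
    exact (bdry y hy).symm
  have m1 : agreeOn (Λ \ K) (glueWith Λ (exch G Λ Δ' η p).1 η) = agreeOn (S := S) (Λ \ K) (glueWith Λ p.1 η) :=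
    agreeOn_congr fun x hx => e1off x (Finset.mem_sdiff.1 hx).2
  have m2 : agreeOn (Λ \ K) (glueWith Λ (exch G Λ Δ' η p).2 η) = agreeOn (S := S) (Λ \ K) (glueWith Λ p.2 η) :=
    agreeOn_congr fun x hx => e2off x (Finset.mem_sdiff.1 hx).2
  rw [fac, fac, fac p.1, fac p.2, q1, q2, m1, m2]
  ring

end Weights


/-! ### The bad event on pairs of `Λ`-configurations and the product measure -/

section BadEvent

variable {G : SimpleGraph V} {Λ Δ Δ' : Finset V} {η : V → S}

omit [MeasurableSpace S] in
/-- Membership in `{Δ ↔≠ Δ′ in Λ}` only reads the two configurations on `Λ`. [folklore] -/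
private theorem mem_disagreementIn_of_agree {ξ₁ ξ₂ τ₁ τ₂ : V → S} (h₁ : ∀ v ∈ Λ, ξ₁ v = τ₁ v)
    (h₂ : ∀ v ∈ Λ, ξ₂ v = τ₂ v) (h : (ξ₁, ξ₂) ∈ disagreementIn (S := S) G Λ Δ Δ') :
    (τ₁, τ₂) ∈ disagreementIn (S := S) G Λ Δ Δ' := by
  obtain ⟨x, hx, y, hy, w, hw⟩ := h
  refine ⟨x, hx, y, hy, w, fun v hv => ⟨(hw v hv).1, ?_⟩⟩
  have := (hw v hv).2
  simp only at this ⊢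
  rw [← h₁ v (hw v hv).1, ← h₂ v (hw v hv).1]
  exact this

/-- The bad event read on pairs of `Λ`-configurations (extended by `η`). [cite: GeorgiiHaggstromMaes2001, Corollary 7.11] -/
def Bad (G : SimpleGraph V) (Λ Δ Δ' : Finset V) (η : V → S) (p : (↥Λ → S) × (↥Λ → S)) : Prop :=
  (glueWith Λ p.1 η, glueWith Λ p.2 η) ∈ disagreementIn (S := S) G Λ Δ Δ'

omit [MeasurableSpace S] in
/-- The bad event in terms of the disagreement predicate (definitional). [cite: GeorgiiHaggstromMaes2001, Corollary 7.11] -/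
theorem bad_iff {p : (↥Λ → S) × (↥Λ → S)} :
    Bad G Λ Δ Δ' η p ↔ ∃ x ∈ Δ, ∃ y ∈ Δ', ∃ w : G.Walk x y, ∀ v ∈ w.support, v ∈ Λ ∧ Dis Λ η p v :=
  Iff.rfl

omit [MeasurableSpace S] in
/-- The exchange preserves the bad event. [cite: GeorgiiHaggstromMaes2001, Proposition 7.10 (proof)] -/
theorem bad_exch (p : (↥Λ → S) × (↥Λ → S)) : Bad G Λ Δ Δ' η (exch G Λ Δ' η p) ↔ Bad G Λ Δ Δ' η p := by
  rw [bad_iff, bad_iff]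
  simp only [dis_exch]

omit [MeasurableSpace S] in
/-- `{Δ ↔≠ Δ′ in Λ}` is the union of the fibre rectangles over the bad pairs. [folklore] -/
private theorem disagreementIn_eq_biUnion [Fintype (↥Λ → S)] [DecidablePred (Bad G Λ Δ Δ' η)] :
    disagreementIn (S := S) G Λ Δ Δ' =
      ⋃ p ∈ (Finset.univ.filter (Bad G Λ Δ Δ' η)), fiber Λ η p.1 ×ˢ fiber Λ η p.2 := by
  ext ⟨σ, σ'⟩
  simp only [Set.mem_iUnion, Finset.mem_filter, Finset.mem_univ, true_and, Set.mem_prod, exists_prop]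
  constructor
  · intro h
    refine ⟨(fun x : ↥Λ => σ x, fun x : ↥Λ => σ' x), ?_, mem_fiber_restrict Λ η σ, mem_fiber_restrict Λ η σ'⟩
    show (glueWith Λ (fun x : ↥Λ => σ x) η, glueWith Λ (fun x : ↥Λ => σ' x) η) ∈
      disagreementIn (S := S) G Λ Δ Δ'
    exact mem_disagreementIn_of_agree (fun v hv => (glueWith_apply_mem Λ (fun x : ↥Λ => σ x) η hv).symm)
      (fun v hv => (glueWith_apply_mem Λ (fun x : ↥Λ => σ' x) η hv).symm) h
  · rintro ⟨p, hp, h1, h2⟩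
    refine mem_disagreementIn_of_agree (fun v hv => ?_) (fun v hv => ?_) hp
    · rw [glueWith_apply_mem Λ _ η hv]; exact (((mem_fiber Λ η).1 h1) v hv).symm
    · rw [glueWith_apply_mem Λ _ η hv]; exact (((mem_fiber Λ η).1 h2) v hv).symm

/-- The product measure of `{Δ ↔≠ Δ′ in Λ}` as a finite sum of products of fibre weights. [folklore] -/
private theorem prod_real_disagreementIn [MeasurableSingletonClass S] [Fintype (↥Λ → S)]
    [DecidablePred (Bad G Λ Δ Δ' η)] (μ : Measure (V → S)) [IsProbabilityMeasure μ] :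
    (μ.prod μ).real (disagreementIn (S := S) G Λ Δ Δ') =
      ∑ p ∈ Finset.univ.filter (Bad G Λ Δ Δ' η), μ.real (fiber Λ η p.1) * μ.real (fiber Λ η p.2) := by
  rw [disagreementIn_eq_biUnion (η := η), measureReal_biUnion_finset]
  · refine Finset.sum_congr rfl fun p _ => ?_
    rw [measureReal_def, Measure.prod_prod, ENNReal.toReal_mul, measureReal_def, measureReal_def]
  · intro p _ q _ hpq
    rw [Function.onFun, Set.disjoint_prod]
    by_cases h1 : p.1 = q.1
    · right
      have h2 : p.2 ≠ q.2 := fun h2 => hpq (Prod.ext h1 h2)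
      exact pairwiseDisjoint_fiber Λ η h2
    · left; exact pairwiseDisjoint_fiber Λ η h1
  · intro p _
    exact (measurableSet_fiber Λ η p.1).prod (measurableSet_fiber Λ η p.2)

end BadEvent

/-! ### Assembly: Corollary 7.11 via the swapping lemma -/

section Assembly

open Literature.MathematicalPhysics.QuantumFieldTheory.AdhikariCao2022

variable [MeasurableSingletonClass S] [DecidableEq V] {G : SimpleGraph V} [G.LocallyFinite]
  {γ : Specification V S} {Λ Δ Δ' : Finset V} {η : V → S}

/-- A real shift-covariance computed on a finite weight with total mass one is the plain covariance. [folklore] -/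
private theorem sum_shift_cov {Ω : Type*} [Fintype Ω] (ν F₁ F₂ : Ω → ℝ) (c₁ c₂ : ℝ) (hν₁ : ∑ ζ, ν ζ = 1) :
    (∑ ζ, ν ζ * ((F₁ ζ - c₁) * (F₂ ζ - c₂))) -
        (∑ ζ, ν ζ * (F₁ ζ - c₁)) * (∑ ζ, ν ζ * (F₂ ζ - c₂)) =
      (∑ ζ, ν ζ * (F₁ ζ * F₂ ζ)) - (∑ ζ, ν ζ * F₁ ζ) * (∑ ζ, ν ζ * F₂ ζ) := by
  have e1 : ∑ ζ, ν ζ * ((F₁ ζ - c₁) * (F₂ ζ - c₂)) =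
      (∑ ζ, ν ζ * (F₁ ζ * F₂ ζ)) - c₂ * (∑ ζ, ν ζ * F₁ ζ) - c₁ * (∑ ζ, ν ζ * F₂ ζ) + c₁ * c₂ := by
    have : ∀ ζ, ν ζ * ((F₁ ζ - c₁) * (F₂ ζ - c₂)) =
        ν ζ * (F₁ ζ * F₂ ζ) - c₂ * (ν ζ * F₁ ζ) - c₁ * (ν ζ * F₂ ζ) + c₁ * c₂ * ν ζ := fun ζ => by ring
    simp only [this, Finset.sum_add_distrib, Finset.sum_sub_distrib, ← Finset.mul_sum, hν₁, mul_one]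
  have e2 : ∑ ζ, ν ζ * (F₁ ζ - c₁) = (∑ ζ, ν ζ * F₁ ζ) - c₁ := by
    simp only [mul_sub, Finset.sum_sub_distrib, ← Finset.sum_mul, hν₁, one_mul]
  have e3 : ∑ ζ, ν ζ * (F₂ ζ - c₂) = (∑ ζ, ν ζ * F₂ ζ) - c₂ := by
    simp only [mul_sub, Finset.sum_sub_distrib, ← Finset.sum_mul, hν₁, one_mul]
  rw [e1, e2, e3]; ring

/-- **[GHM01] Corollary 7.11 for Markov specifications with finite spin space, proved** (via the
exchange map on disagreement clusters and the tree's swapping lemma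
`AdhikariCao2022.norm_fcov_le_of_isSwappingMap`). [cite: GeorgiiHaggstromMaes2001, Corollary 7.11] -/
theorem covariance_bound [Finite S] (hγ : IsSpecification γ) (hM : γ.IsMarkov G)
    (hΔ : Δ ⊆ Λ) (hΔ' : Δ' ⊆ Λ) (f g : (V → S) → ℝ)
    (hdf : DependsOn f (↑Δ : Set V)) (hdg : DependsOn g (↑Δ' : Set V)) {af bf ag bg : ℝ}
    (hfb : ∀ σ, af ≤ f σ ∧ f σ ≤ bf) (hgb : ∀ σ, ag ≤ g σ ∧ g σ ≤ bg) :
    |∫ σ, f σ * g σ ∂(γ Λ η) - (∫ σ, f σ ∂(γ Λ η)) * ∫ σ, g σ ∂(γ Λ η)| ≤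
      (bf - af) * (bg - ag) * ((γ Λ η).prod (γ Λ η)).real (disagreementIn G Λ Δ Δ') := by
  classical
  haveI := hγ.isProbability Λ η
  haveI : Fintype S := Fintype.ofFinite S
  set μ := γ Λ η with hμ
  -- the finite weight
  set ν : (↥Λ → S) → ℝ := fun ζ => μ.real (fiber Λ η ζ) with hν
  have hν0 : ∀ ζ, 0 ≤ ν ζ := fun ζ => measureReal_nonneg
  have hν1 : ∑ ζ, ν ζ = 1 := sum_real_fiber Λ η μ
  -- local functions read on `Λ`-configurations
  have hdfΛ : DependsOn f (↑Λ : Set V) := hdf.mono (Finset.coe_subset.2 hΔ)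
  have hdgΛ : DependsOn g (↑Λ : Set V) := hdg.mono (Finset.coe_subset.2 hΔ')
  have hdfg : DependsOn (fun σ => f σ * g σ) (↑Λ : Set V) := fun σ τ h => by
    simp only; rw [hdfΛ h, hdgΛ h]
  set F₁ : (↥Λ → S) → ℝ := fun ζ => f (glueWith Λ ζ η) with hF₁
  set F₂ : (↥Λ → S) → ℝ := fun ζ => g (glueWith Λ ζ η) with hF₂
  have If : ∫ σ, f σ ∂μ = ∑ ζ, ν ζ * F₁ ζ := integral_eq_sum_fiber Λ η μ hdfΛ
  have Ig : ∫ σ, g σ ∂μ = ∑ ζ, ν ζ * F₂ ζ := integral_eq_sum_fiber Λ η μ hdgΛ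
  have Ifg : ∫ σ, f σ * g σ ∂μ = ∑ ζ, ν ζ * (F₁ ζ * F₂ ζ) := integral_eq_sum_fiber Λ η μ hdfg
  -- centred complex versions
  set cf := (af + bf) / 2 with hcf
  set cg := (ag + bg) / 2 with hcg
  set h₁ : (↥Λ → S) → ℂ := fun ζ => ((F₁ ζ - cf : ℝ) : ℂ) with hh₁
  set h₂ : (↥Λ → S) → ℂ := fun ζ => ((F₂ ζ - cg : ℝ) : ℂ) with hh₂
  have hM1 : ∀ ζ, ‖h₁ ζ‖ ≤ (bf - af) / 2 := fun ζ => by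
    rw [hh₁]; dsimp only; rw [Complex.norm_real, Real.norm_eq_abs, abs_le]
    constructor <;> linarith [(hfb (glueWith Λ ζ η)).1, (hfb (glueWith Λ ζ η)).2]
  have hM2 : ∀ ζ, ‖h₂ ζ‖ ≤ (bg - ag) / 2 := fun ζ => by
    rw [hh₂]; dsimp only; rw [Complex.norm_real, Real.norm_eq_abs, abs_le]
    constructor <;> linarith [(hgb (glueWith Λ ζ η)).1, (hgb (glueWith Λ ζ η)).2]
  -- the good event and the swapping map
  set E : Finset ((↥Λ → S) × (↥Λ → S)) := Finset.univ.filter fun p => ¬ Bad G Λ Δ Δ' η p with hE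
  have hmemE : ∀ p, p ∈ E ↔ ¬ Bad G Λ Δ Δ' η p := fun p => by simp [hE]
  have hmaps : ∀ p ∈ E, exch G Λ Δ' η p ∈ E := fun p hp => by
    rw [hmemE] at hp ⊢; rwa [bad_exch]
  have hT : IsSwappingMap ν E h₁ h₂ (exch G Λ Δ' η) := by
    refine ⟨⟨fun p hp => ?_, fun p _ q _ hpq => ?_, fun q hq => ?_⟩, fun p _ => ?_, fun p hp => ?_⟩
    · exact Finset.mem_coe.2 (hmaps p (Finset.mem_coe.1 hp))
    · calc p = exch G Λ Δ' η (exch G Λ Δ' η p) := (exch_exch p).symm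
        _ = exch G Λ Δ' η (exch G Λ Δ' η q) := by rw [hpq]
        _ = q := exch_exch q
    · exact ⟨exch G Λ Δ' η q, Finset.mem_coe.2 (hmaps q (Finset.mem_coe.1 hq)), exch_exch q⟩
    · -- weight invariance
      simp only [hν, measureReal_def]
      rw [← ENNReal.toReal_mul, ← ENNReal.toReal_mul, weight_exch hγ hM p]
    · -- the swap identity: `f` does not see the exchange region, `g` sees `p.2` on `Δ′`
      have hp' : ¬ Bad G Λ Δ Δ' η p := (hmemE p).1 hp
      have hf1 : F₁ (exch G Λ Δ' η p).1 = F₁ p.1 := by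
        refine hdf fun x hx => ?_
        have hxΛ : x ∈ Λ := hΔ (Finset.mem_coe.1 hx)
        rw [glueWith_apply_mem Λ _ η hxΛ, glueWith_apply_mem Λ _ η hxΛ, exch_fst_apply]
        rw [if_neg]
        intro hxK
        obtain ⟨-, y, hy, w, hw⟩ := mem_region.1 hxK
        exact hp' ⟨x, Finset.mem_coe.1 hx, y, hy, w, hw⟩
      have hg1 : F₂ (exch G Λ Δ' η p).1 = F₂ p.2 := by
        refine hdg fun x hx => ?_
        have hxΛ : x ∈ Λ := hΔ' (Finset.mem_coe.1 hx)
        rw [glueWith_apply_mem Λ _ η hxΛ, glueWith_apply_mem Λ _ η hxΛ, exch_fst_apply]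
        by_cases hxK : x ∈ region G Λ Δ' η p
        · rw [if_pos hxK]
        · rw [if_neg hxK]
          by_contra hne
          exact hxK (mem_region_of_dis (Finset.mem_coe.1 hx) hxΛ ((dis_iff_of_mem hxΛ).2 hne))
      simp only [hh₁, hh₂, hf1, hg1]
  -- the swapping lemma
  have key := norm_fcov_le_of_isSwappingMap hν0 hν1 hT hM1 hM2
  -- identify the covariance
  have hfcov : fcov ν h₁ h₂ =
      (((∑ ζ, ν ζ * ((F₁ ζ - cf) * (F₂ ζ - cg))) -
        (∑ ζ, ν ζ * (F₁ ζ - cf)) * (∑ ζ, ν ζ * (F₂ ζ - cg)) : ℝ) : ℂ) := by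
    simp only [fcov, fexpect, hh₁, hh₂]; push_cast; ring
  have hcovR : ‖fcov ν h₁ h₂‖ =
      |∫ σ, f σ * g σ ∂μ - (∫ σ, f σ ∂μ) * ∫ σ, g σ ∂μ| := by
    rw [hfcov, Complex.norm_real, Real.norm_eq_abs, sum_shift_cov ν F₁ F₂ cf cg hν1, Ifg, If, Ig]
  -- identify the probability of the bad event
  have hP : pairProbNotMem ν E = (μ.prod μ).real (disagreementIn G Λ Δ Δ') := by
    rw [pairProbNotMem, prod_real_disagreementIn (η := η) μ]
    refine Finset.sum_congr ?_ fun _ _ => rfl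
    ext p
    simp only [hE, Finset.mem_compl, Finset.mem_filter, Finset.mem_univ, true_and, not_not]
  -- conclude
  have hP0 : 0 ≤ (μ.prod μ).real (disagreementIn G Λ Δ Δ') := measureReal_nonneg
  have hab : 0 ≤ (bf - af) * (bg - ag) := by
    obtain ⟨σ⟩ : Nonempty (V → S) := by
      by_contra hne
      have h0 : μ Set.univ = 0 := by
        rw [Set.univ_eq_empty_iff.2 (not_nonempty_iff.1 hne), measure_empty]
      exact zero_ne_one (h0.symm.trans measure_univ)
    exact mul_nonneg (by linarith [(hfb σ).1, (hfb σ).2]) (by linarith [(hgb σ).1, (hgb σ).2])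
  rw [← hcovR]
  calc ‖fcov ν h₁ h₂‖ ≤ 2 * ((bf - af) / 2) * ((bg - ag) / 2) * pairProbNotMem ν E := key
    _ = (bf - af) * (bg - ag) * (μ.prod μ).real (disagreementIn G Λ Δ Δ') / 2 := by rw [hP]; ring
    _ ≤ (bf - af) * (bg - ag) * (μ.prod μ).real (disagreementIn G Λ Δ Δ') := by
        linarith [mul_nonneg hab hP0]

end Assembly

/-! ### [GHM01] Proposition 7.10: two boundary conditions, exchange on the disagreement cluster of `Δ`

For `η ≠ η′` the pair `(ξ, ξ′) ∼ γ_Λ^η ⊗ γ_Λ^{η′}` disagrees OFF `Λ` exactly where `η ≠ η′`.  The exchange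
region is now the part in `Λ` of the disagreement cluster of `Δ` (paths of disagreement through arbitrary
vertices), and the good event is the absence of a path of disagreement from `Δ` to a vertex outside `Λ`
(`{Δ ↔≠ ∂Λ}ᶜ`); on the good event the outer boundary of the region again carries no disagreement, so the
exchange preserves `γ_Λ^η(ξ) γ_Λ^{η′}(ξ′)` ([vdB93] proof of Thm 1: «T is also measure preserving … Markov
property»), and after the exchange the SECOND copy shows the first copy's spins on `Δ`.  Hence the good
parts of `γ_Λ^η(A)` and `γ_Λ^{η′}(A)` cancel and `|γ_Λ^η(A) − γ_Λ^{η′}(A)| ≤ (γ_Λ^η ⊗ γ_Λ^{η′})(Δ ↔≠ ∂Λ)`. -/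

section TwoBoundaryConditions

variable (G : SimpleGraph V) (Λ Δ : Finset V) (η η' : V → S)

/-- Disagreement at a vertex of a pair of `Λ`-configurations, the first extended by `η`, the second by `η′`
(off `Λ` this is disagreement of the boundary conditions). [cite: GeorgiiHaggstromMaes2001, Proposition 7.10 (proof)] -/
def Dis₂ (p : (↥Λ → S) × (↥Λ → S)) (v : V) : Prop := glueWith Λ p.1 η v ≠ glueWith Λ p.2 η' v

/-- `v` belongs to the disagreement cluster of `Δ`: a path of disagreement (through arbitrary vertices) from
`v` to a vertex of `Δ`. [cite: Vandenberg1993, Theorem 1 (proof, the cluster C_A)] -/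
def Conn₂ (p : (↥Λ → S) × (↥Λ → S)) (v : V) : Prop :=
  ∃ x ∈ Δ, ∃ w : G.Walk v x, ∀ u ∈ w.support, Dis₂ Λ η η' p u

/-- The exchange region: the part in `Λ` of the disagreement cluster of `Δ`. [cite: Vandenberg1993, Theorem 1 (proof, the cluster C_A)] -/
def region₂ (p : (↥Λ → S) × (↥Λ → S)) : Finset V := by
  classical exact Λ.filter (Conn₂ G Λ Δ η η' p)

/-- The exchange map: swap the two `Λ`-configurations on the exchange region. [cite: Vandenberg1993, Theorem 1 (proof, the transformation T)] -/
def exch₂ (p : (↥Λ → S) × (↥Λ → S)) : (↥Λ → S) × (↥Λ → S) := by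
  classical exact
  (fun x => if (x : V) ∈ region₂ G Λ Δ η η' p then p.2 x else p.1 x,
   fun x => if (x : V) ∈ region₂ G Λ Δ η η' p then p.1 x else p.2 x)

/-- The bad event `{Δ ↔≠ ∂Λ}` read on pairs of `Λ`-configurations (extended by `η`, resp. `η′`). [cite: GeorgiiHaggstromMaes2001, Proposition 7.10] -/
def Bad₂ (p : (↥Λ → S) × (↥Λ → S)) : Prop :=
  (glueWith Λ p.1 η, glueWith Λ p.2 η') ∈ disagreementExit (S := S) G Λ Δ

variable {G Λ Δ η η'}

omit [MeasurableSpace S] in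
/-- The bad event in terms of the disagreement predicate (definitional). [cite: GeorgiiHaggstromMaes2001, Proposition 7.10] -/
theorem bad₂_iff {p : (↥Λ → S) × (↥Λ → S)} :
    Bad₂ G Λ Δ η η' p ↔ ∃ x ∈ Δ, ∃ y, y ∉ Λ ∧ ∃ w : G.Walk x y, ∀ v ∈ w.support, Dis₂ Λ η η' p v :=
  Iff.rfl

omit [MeasurableSpace S] in
/-- Membership in the exchange region. [cite: Vandenberg1993, Theorem 1 (proof)] -/
theorem mem_region₂ {p : (↥Λ → S) × (↥Λ → S)} {v : V} :
    v ∈ region₂ G Λ Δ η η' p ↔ v ∈ Λ ∧ Conn₂ G Λ Δ η η' p v := by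
  classical
  unfold region₂; rw [Finset.mem_filter]

omit [MeasurableSpace S] in
/-- Inside `Λ` disagreement is disagreement of the `Λ`-configurations. [folklore] -/
private theorem dis₂_iff_of_mem {p : (↥Λ → S) × (↥Λ → S)} {v : V} (hv : v ∈ Λ) :
    Dis₂ Λ η η' p v ↔ p.1 ⟨v, hv⟩ ≠ p.2 ⟨v, hv⟩ := by
  unfold Dis₂; rw [glueWith_apply_mem Λ p.1 η hv, glueWith_apply_mem Λ p.2 η' hv]

omit [MeasurableSpace S] in
/-- Off `Λ` disagreement is disagreement of the boundary conditions. [folklore] -/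
private theorem dis₂_iff_of_not_mem {p : (↥Λ → S) × (↥Λ → S)} {v : V} (hv : v ∉ Λ) :
    Dis₂ Λ η η' p v ↔ η v ≠ η' v := by
  unfold Dis₂; rw [glueWith_apply_not_mem Λ p.1 η hv, glueWith_apply_not_mem Λ p.2 η' hv]

omit [MeasurableSpace S] in
open Classical in
/-- First component of the exchange, pointwise. [folklore] -/
private theorem exch₂_fst_apply {p : (↥Λ → S) × (↥Λ → S)} (x : ↥Λ) :
    (exch₂ G Λ Δ η η' p).1 x = if (x : V) ∈ region₂ G Λ Δ η η' p then p.2 x else p.1 x := rfl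

omit [MeasurableSpace S] in
open Classical in
/-- Second component of the exchange, pointwise. [folklore] -/
private theorem exch₂_snd_apply {p : (↥Λ → S) × (↥Λ → S)} (x : ↥Λ) :
    (exch₂ G Λ Δ η η' p).2 x = if (x : V) ∈ region₂ G Λ Δ η η' p then p.1 x else p.2 x := rfl

omit [MeasurableSpace S] in
/-- The exchange does not change the disagreement set. [cite: Vandenberg1993, Theorem 1 (proof)] -/
theorem dis₂_exch₂ (p : (↥Λ → S) × (↥Λ → S)) (v : V) :
    Dis₂ Λ η η' (exch₂ G Λ Δ η η' p) v ↔ Dis₂ Λ η η' p v := by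
  classical
  by_cases hv : v ∈ Λ
  · rw [dis₂_iff_of_mem hv, dis₂_iff_of_mem hv, exch₂_fst_apply, exch₂_snd_apply]
    by_cases hK : v ∈ region₂ G Λ Δ η η' p
    · rw [if_pos hK, if_pos hK]; exact ne_comm
    · rw [if_neg hK, if_neg hK]
  · rw [dis₂_iff_of_not_mem hv, dis₂_iff_of_not_mem hv]

omit [MeasurableSpace S] in
/-- The exchange does not change the disagreement cluster of `Δ`. [cite: Vandenberg1993, Theorem 1 (proof)] -/
theorem conn₂_exch₂ (p : (↥Λ → S) × (↥Λ → S)) (v : V) :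
    Conn₂ G Λ Δ η η' (exch₂ G Λ Δ η η' p) v ↔ Conn₂ G Λ Δ η η' p v := by
  unfold Conn₂
  simp only [dis₂_exch₂]

omit [MeasurableSpace S] in
/-- The exchange does not change the exchange region. [cite: Vandenberg1993, Theorem 1 (proof)] -/
theorem region₂_exch₂ (p : (↥Λ → S) × (↥Λ → S)) :
    region₂ G Λ Δ η η' (exch₂ G Λ Δ η η' p) = region₂ G Λ Δ η η' p := by
  ext v; rw [mem_region₂, mem_region₂, conn₂_exch₂]

omit [MeasurableSpace S] in
/-- The exchange map is an involution. [cite: Vandenberg1993, Theorem 1 (proof): «This transformation is obviously 1-1»] -/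
theorem exch₂_exch₂ (p : (↥Λ → S) × (↥Λ → S)) : exch₂ G Λ Δ η η' (exch₂ G Λ Δ η η' p) = p := by
  classical
  have hK := region₂_exch₂ (G := G) (Λ := Λ) (Δ := Δ) (η := η) (η' := η') p
  have h1 : (exch₂ G Λ Δ η η' (exch₂ G Λ Δ η η' p)).1 = p.1 := by
    funext x
    rw [exch₂_fst_apply, hK, exch₂_fst_apply, exch₂_snd_apply]
    by_cases hx : (x : V) ∈ region₂ G Λ Δ η η' p
    · rw [if_pos hx, if_pos hx]
    · rw [if_neg hx, if_neg hx]
  have h2 : (exch₂ G Λ Δ η η' (exch₂ G Λ Δ η η' p)).2 = p.2 := by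
    funext x
    rw [exch₂_snd_apply, hK, exch₂_fst_apply, exch₂_snd_apply]
    by_cases hx : (x : V) ∈ region₂ G Λ Δ η η' p
    · rw [if_pos hx, if_pos hx]
    · rw [if_neg hx, if_neg hx]
  exact Prod.ext h1 h2

omit [MeasurableSpace S] in
/-- The exchange preserves the bad event. [cite: GeorgiiHaggstromMaes2001, Proposition 7.10 (proof)] -/
theorem bad₂_exch₂ (p : (↥Λ → S) × (↥Λ → S)) :
    Bad₂ G Λ Δ η η' (exch₂ G Λ Δ η η' p) ↔ Bad₂ G Λ Δ η η' p := by
  rw [bad₂_iff, bad₂_iff]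
  simp only [dis₂_exch₂]

omit [MeasurableSpace S] in
/-- On the good event the outer boundary of the exchange region carries no disagreement: a disagreeing
neighbour in `Λ` would belong to the cluster, one outside `Λ` would complete a path `Δ ↔≠ ∂Λ`. [cite: Vandenberg1993, Theorem 1 (proof)] -/
theorem not_dis₂_of_adj_region₂ {p : (↥Λ → S) × (↥Λ → S)} (hp : ¬ Bad₂ G Λ Δ η η' p) {x y : V}
    (hx : x ∈ region₂ G Λ Δ η η' p) (hyK : y ∉ region₂ G Λ Δ η η' p) (hadj : G.Adj y x) :
    ¬ Dis₂ Λ η η' p y := by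
  intro hdis
  obtain ⟨-, z, hz, w, hw⟩ := mem_region₂.1 hx
  have hsupp : ∀ u ∈ (SimpleGraph.Walk.cons hadj w).support, Dis₂ Λ η η' p u := by
    intro u hu
    rw [SimpleGraph.Walk.support_cons, List.mem_cons] at hu
    rcases hu with rfl | hu
    · exact hdis
    · exact hw u hu
  by_cases hyΛ : y ∈ Λ
  · exact hyK (mem_region₂.2 ⟨hyΛ, z, hz, SimpleGraph.Walk.cons hadj w, hsupp⟩)
  · refine hp ⟨z, hz, y, hyΛ, (SimpleGraph.Walk.cons hadj w).reverse, fun u hu => ?_⟩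
    rw [SimpleGraph.Walk.support_reverse, List.mem_reverse] at hu
    exact hsupp u hu

omit [MeasurableSpace S] in
/-- After the exchange the second copy shows the first copy's spins on `Δ` (sites of `Δ` outside the
region agree). [cite: Vandenberg1993, Theorem 1 (proof)] -/
theorem exch₂_snd_eq_fst_of_mem {p : (↥Λ → S) × (↥Λ → S)} {x : V} (hx : x ∈ Δ) (hxΛ : x ∈ Λ) :
    (exch₂ G Λ Δ η η' p).2 ⟨x, hxΛ⟩ = p.1 ⟨x, hxΛ⟩ := by
  rw [exch₂_snd_apply]
  by_cases hxK : x ∈ region₂ G Λ Δ η η' p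
  · rw [if_pos hxK]
  · rw [if_neg hxK]
    by_contra hne
    exact hxK (mem_region₂.2 ⟨hxΛ, x, hx, SimpleGraph.Walk.nil, fun u hu => by
      rw [SimpleGraph.Walk.support_nil, List.mem_singleton] at hu
      subst hu
      exact (dis₂_iff_of_mem hxΛ).2 fun h => hne h.symm⟩)

/-- **The exchange preserves the product weight** `γ_Λ(fibre ζ₁ | η) γ_Λ(fibre ζ₂ | η′)` on the good
event (consistency + Markov property; the two kernels differ only in the boundary condition, which is
not seen by the `K`-factors because `∂K` carries no disagreement). [cite: Vandenberg1993, Theorem 1 (proof: «T is also measure preserving»)] -/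
theorem weight_exch₂ [MeasurableSingletonClass S] [DecidableEq V] [G.LocallyFinite]
    {γ : Specification V S} (hγ : IsSpecification γ) (hM : γ.IsMarkov G)
    {p : (↥Λ → S) × (↥Λ → S)} (hp : ¬ Bad₂ G Λ Δ η η' p) :
    γ Λ η (fiber Λ η (exch₂ G Λ Δ η η' p).1) * γ Λ η' (fiber Λ η' (exch₂ G Λ Δ η η' p).2) =
      γ Λ η (fiber Λ η p.1) * γ Λ η' (fiber Λ η' p.2) := by
  classical
  set K := region₂ G Λ Δ η η' p with hKdef
  have hK : K ⊆ Λ := fun v hv => (mem_region₂.1 hv).1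
  -- factorise all four weights through `K`
  have fac : ∀ (θ : V → S) (ζ : ↥Λ → S), γ Λ θ (fiber Λ θ ζ) =
      γ K (glueWith Λ ζ θ) (agreeOn K (glueWith Λ ζ θ)) *
        γ Λ θ (agreeOn (Λ \ K) (glueWith Λ ζ θ)) :=
    fun θ ζ => weight_factor hγ hK fun x hx => glueWith_apply_not_mem Λ ζ θ hx
  -- values of the exchanged configurations
  have e1K : ∀ x ∈ K, glueWith Λ (exch₂ G Λ Δ η η' p).1 η x = glueWith Λ p.2 η' x := by
    intro x hx
    rw [glueWith_apply_mem Λ _ η (hK hx), glueWith_apply_mem Λ _ η' (hK hx), exch₂_fst_apply, if_pos hx]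
  have e2K : ∀ x ∈ K, glueWith Λ (exch₂ G Λ Δ η η' p).2 η' x = glueWith Λ p.1 η x := by
    intro x hx
    rw [glueWith_apply_mem Λ _ η' (hK hx), glueWith_apply_mem Λ _ η (hK hx), exch₂_snd_apply, if_pos hx]
  have e1off : ∀ x, x ∉ K → glueWith Λ (exch₂ G Λ Δ η η' p).1 η x = glueWith Λ p.1 η x := by
    intro x hx
    by_cases hxΛ : x ∈ Λ
    · rw [glueWith_apply_mem Λ _ η hxΛ, glueWith_apply_mem Λ _ η hxΛ, exch₂_fst_apply, if_neg hx]
    · rw [glueWith_apply_not_mem Λ _ η hxΛ, glueWith_apply_not_mem Λ _ η hxΛ]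
  have e2off : ∀ x, x ∉ K → glueWith Λ (exch₂ G Λ Δ η η' p).2 η' x = glueWith Λ p.2 η' x := by
    intro x hx
    by_cases hxΛ : x ∈ Λ
    · rw [glueWith_apply_mem Λ _ η' hxΛ, glueWith_apply_mem Λ _ η' hxΛ, exch₂_snd_apply, if_neg hx]
    · rw [glueWith_apply_not_mem Λ _ η' hxΛ, glueWith_apply_not_mem Λ _ η' hxΛ]
  -- the boundary of `K` carries no disagreement (good event)
  have bdry : ∀ y ∈ outerBoundary G K, glueWith Λ p.1 η y = glueWith Λ p.2 η' y := by
    intro y hy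
    obtain ⟨hyK, x, hx, hadj⟩ := mem_outerBoundary_iff.1 hy
    by_contra hne
    exact not_dis₂_of_adj_region₂ hp hx hyK hadj hne
  -- the `K`-factors are exchanged (Markov property), the `Λ ∖ K`-factors are unchanged
  have q1 : γ K (glueWith Λ (exch₂ G Λ Δ η η' p).1 η) (agreeOn K (glueWith Λ (exch₂ G Λ Δ η η' p).1 η)) =
      γ K (glueWith Λ p.2 η') (agreeOn K (glueWith Λ p.2 η')) := by
    rw [agreeOn_congr e1K]
    refine hM K _ _ (fun y hy => ?_) _ (measurableSet_agreeOn K _) (dependsOn_mem_agreeOn K _)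
    rw [e1off y (mem_outerBoundary_iff.1 hy).1]
    exact bdry y hy
  have q2 : γ K (glueWith Λ (exch₂ G Λ Δ η η' p).2 η') (agreeOn K (glueWith Λ (exch₂ G Λ Δ η η' p).2 η')) =
      γ K (glueWith Λ p.1 η) (agreeOn K (glueWith Λ p.1 η)) := by
    rw [agreeOn_congr e2K]
    refine hM K _ _ (fun y hy => ?_) _ (measurableSet_agreeOn K _) (dependsOn_mem_agreeOn K _)
    rw [e2off y (mem_outerBoundary_iff.1 hy).1]
    exact (bdry y hy).symm
  have m1 : agreeOn (Λ \ K) (glueWith Λ (exch₂ G Λ Δ η η' p).1 η) =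
      agreeOn (S := S) (Λ \ K) (glueWith Λ p.1 η) :=
    agreeOn_congr fun x hx => e1off x (Finset.mem_sdiff.1 hx).2
  have m2 : agreeOn (Λ \ K) (glueWith Λ (exch₂ G Λ Δ η η' p).2 η') =
      agreeOn (S := S) (Λ \ K) (glueWith Λ p.2 η') :=
    agreeOn_congr fun x hx => e2off x (Finset.mem_sdiff.1 hx).2
  rw [fac η, fac η', fac η p.1, fac η' p.2, q1, q2, m1, m2]
  ring

/-- Reindexing the good part by a weight-preserving bijection after which the second copy shows the first
copy's `Δ`-spins: the good parts of the two expectations coincide. [cite: Vandenberg1993, Theorem 1 (proof)] -/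
private theorem sum_good_eq {Ω : Type*} (E : Finset (Ω × Ω)) (ν₁ ν₂ h : Ω → ℝ) (T : Ω × Ω → Ω × Ω)
    (hbij : Set.BijOn T (E : Set (Ω × Ω)) (E : Set (Ω × Ω)))
    (hw : ∀ p ∈ E, ν₁ (T p).1 * ν₂ (T p).2 = ν₁ p.1 * ν₂ p.2)
    (hswap : ∀ p ∈ E, h (T p).2 = h p.1) :
    ∑ p ∈ E, ν₁ p.1 * ν₂ p.2 * h p.2 = ∑ p ∈ E, ν₁ p.1 * ν₂ p.2 * h p.1 := by
  have hre : ∑ p ∈ E, ν₁ (T p).1 * ν₂ (T p).2 * h (T p).2 = ∑ p ∈ E, ν₁ p.1 * ν₂ p.2 * h p.2 :=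
    Finset.sum_nbij T (fun p hp => Finset.mem_coe.1 (hbij.mapsTo (Finset.mem_coe.2 hp))) hbij.injOn
      hbij.surjOn (fun _ _ => rfl)
  rw [← hre]
  exact Finset.sum_congr rfl fun p hp => by rw [hw p hp, hswap p hp]

/-- The fibre rectangles over the bad pairs have total `γ_Λ^η ⊗ γ_Λ^{η′}`-mass at most that of `{Δ ↔≠ ∂Λ}`:
by properness both copies follow their boundary conditions on the (finitely many) exit vertices of
witness paths, so the rectangles lie inside the exit event up to a null set. [cite: GeorgiiHaggstromMaes2001, Proposition 7.10 (proof)] -/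
private theorem sum_bad_le_prod_real_exit [MeasurableSingletonClass S] [Fintype (↥Λ → S)]
    {γ : Specification V S} (hγ : IsSpecification γ) (B : Finset ((↥Λ → S) × (↥Λ → S)))
    (hB : ∀ p ∈ B, Bad₂ G Λ Δ η η' p) :
    ∑ p ∈ B, (γ Λ η).real (fiber Λ η p.1) * (γ Λ η').real (fiber Λ η' p.2) ≤
      ((γ Λ η).prod (γ Λ η')).real (disagreementExit (S := S) G Λ Δ) := by
  classical
  haveI := hγ.isProbability Λ η
  haveI := hγ.isProbability Λ η'
  -- witnesses: finitely many off-`Λ` vertices per bad pair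
  have hwit : ∀ p : (↥Λ → S) × (↥Λ → S), ∃ T : Finset V, (∀ v ∈ T, v ∉ Λ) ∧
      (p ∈ B → ∀ σ σ' : V → S, σ ∈ fiber Λ η p.1 → σ' ∈ fiber Λ η' p.2 →
        (∀ v ∈ T, σ v = η v) → (∀ v ∈ T, σ' v = η' v) →
          (σ, σ') ∈ disagreementExit (S := S) G Λ Δ) := by
    intro p
    by_cases hp : p ∈ B
    · obtain ⟨x, hx, y, hy, w, hw⟩ := hB p hp
      refine ⟨w.support.toFinset.filter (fun v => v ∉ Λ), fun v hv => (Finset.mem_filter.1 hv).2,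
        fun _ σ σ' hσ hσ' hT hT' => ⟨x, hx, y, hy, w, fun v hv => ?_⟩⟩
      have hd := hw v hv
      by_cases hvΛ : v ∈ Λ
      · show σ v ≠ σ' v
        rw [(mem_fiber Λ η).1 hσ v hvΛ, (mem_fiber Λ η').1 hσ' v hvΛ]
        exact (dis₂_iff_of_mem hvΛ).1 hd
      · have hvT : v ∈ w.support.toFinset.filter (fun v => v ∉ Λ) :=
          Finset.mem_filter.2 ⟨List.mem_toFinset.2 hv, hvΛ⟩
        show σ v ≠ σ' v
        rw [hT v hvT, hT' v hvT]
        exact (dis₂_iff_of_not_mem hvΛ).1 hd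
    · exact ⟨∅, fun v hv => absurd hv (Finset.notMem_empty v), fun h => absurd h hp⟩
  choose T hTΛ hT using hwit
  -- the full-measure sets on which both copies follow their boundary condition on all witnesses
  set F₁ : Set (V → S) := {σ | ∀ p, ∀ v ∈ T p, σ v = η v} with hF₁
  set F₂ : Set (V → S) := {σ | ∀ p, ∀ v ∈ T p, σ v = η' v} with hF₂
  have h1 : ∀ᵐ σ ∂(γ Λ η), σ ∈ F₁ := by
    filter_upwards [hγ.proper Λ η] with σ hσ
    exact fun p v hv => hσ v (hTΛ p v hv)
  have h2 : ∀ᵐ σ ∂(γ Λ η'), σ ∈ F₂ := by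
    filter_upwards [hγ.proper Λ η'] with σ hσ
    exact fun p v hv => hσ v (hTΛ p v hv)
  have hnull : ((γ Λ η).prod (γ Λ η')) (F₁ ×ˢ F₂)ᶜ = 0 :=
    Measure.measure_prod_compl_eq_zero (mem_ae_iff.1 h1) (mem_ae_iff.1 h2)
  -- the rectangles
  set R : Set ((V → S) × (V → S)) := ⋃ p ∈ B, fiber Λ η p.1 ×ˢ fiber Λ η' p.2 with hR
  have hRsub : R ∩ (F₁ ×ˢ F₂) ⊆ disagreementExit (S := S) G Λ Δ := by
    rintro ⟨σ, σ'⟩ ⟨hσR, hσF⟩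
    rw [hR, Set.mem_iUnion₂] at hσR
    obtain ⟨p, hp, hpr⟩ := hσR
    rw [Set.mem_prod] at hpr hσF
    exact hT p hp σ σ' hpr.1 hpr.2 (fun v hv => hσF.1 p v hv) (fun v hv => hσF.2 p v hv)
  have hRmeas : ((γ Λ η).prod (γ Λ η')).real R =
      ∑ p ∈ B, (γ Λ η).real (fiber Λ η p.1) * (γ Λ η').real (fiber Λ η' p.2) := by
    rw [hR, measureReal_biUnion_finset]
    · refine Finset.sum_congr rfl fun p _ => ?_
      rw [measureReal_def, Measure.prod_prod, ENNReal.toReal_mul, measureReal_def, measureReal_def]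
    · intro p _ q _ hpq
      rw [Function.onFun, Set.disjoint_prod]
      by_cases hpq1 : p.1 = q.1
      · right
        have hpq2 : p.2 ≠ q.2 := fun h2 => hpq (Prod.ext hpq1 h2)
        exact pairwiseDisjoint_fiber Λ η' hpq2
      · left; exact pairwiseDisjoint_fiber Λ η hpq1
    · intro p _
      exact (measurableSet_fiber Λ η p.1).prod (measurableSet_fiber Λ η' p.2)
  rw [← hRmeas, measureReal_def, measureReal_def]
  refine ENNReal.toReal_mono (measure_ne_top _ _) ?_
  calc ((γ Λ η).prod (γ Λ η')) R
      ≤ ((γ Λ η).prod (γ Λ η')) (R ∩ (F₁ ×ˢ F₂)) + ((γ Λ η).prod (γ Λ η')) (R \ (F₁ ×ˢ F₂)) :=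
        measure_le_inter_add_sdiff _ _ _
    _ ≤ ((γ Λ η).prod (γ Λ η')) (disagreementExit (S := S) G Λ Δ) +
          ((γ Λ η).prod (γ Λ η')) (F₁ ×ˢ F₂)ᶜ :=
        add_le_add (measure_mono hRsub) (measure_mono (Set.sdiff_subset_compl _ _))
    _ = ((γ Λ η).prod (γ Λ η')) (disagreementExit (S := S) G Λ Δ) := by rw [hnull, add_zero]

/-- **[GHM01] Proposition 7.10 for Markov specifications with finite spin space, proved**: for a
`Δ`-local event `A`, `Δ ⊆ Λ`, `|γ_Λ(A|η) − γ_Λ(A|η′)| ≤ (γ_Λ^η ⊗ γ_Λ^{η′})(Δ ↔≠ ∂Λ)` (exchange on the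
disagreement cluster of `Δ`; the good parts cancel, the bad part is at most the probability of the bad
event). [cite: GeorgiiHaggstromMaes2001, Proposition 7.10] -/
theorem coupling_bound [MeasurableSingletonClass S] [DecidableEq V] [G.LocallyFinite] [Finite S]
    {γ : Specification V S} (hγ : IsSpecification γ) (hM : γ.IsMarkov G) (hΔ : Δ ⊆ Λ)
    {A : Set (V → S)} (hA : MeasurableSet A) (hdA : DependsOn (· ∈ A) (↑Δ : Set V)) :
    |(γ Λ η).real A - (γ Λ η').real A| ≤ ((γ Λ η).prod (γ Λ η')).real (disagreementExit G Λ Δ) := by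
  classical
  haveI := hγ.isProbability Λ η
  haveI := hγ.isProbability Λ η'
  haveI : Fintype S := Fintype.ofFinite S
  set μ₁ := γ Λ η with hμ₁
  set μ₂ := γ Λ η' with hμ₂
  -- the two finite weights
  set ν₁ : (↥Λ → S) → ℝ := fun ζ => μ₁.real (fiber Λ η ζ) with hν₁
  set ν₂ : (↥Λ → S) → ℝ := fun ζ => μ₂.real (fiber Λ η' ζ) with hν₂
  have hν₁0 : ∀ ζ, 0 ≤ ν₁ ζ := fun _ => measureReal_nonneg
  have hν₂0 : ∀ ζ, 0 ≤ ν₂ ζ := fun _ => measureReal_nonneg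
  have hν₁1 : ∑ ζ, ν₁ ζ = 1 := sum_real_fiber Λ η μ₁
  have hν₂1 : ∑ ζ, ν₂ ζ = 1 := sum_real_fiber Λ η' μ₂
  -- the indicator of `A`, read on `Λ`-configurations
  set F : (V → S) → ℝ := A.indicator 1 with hF
  have hdFΔ : DependsOn F (↑Δ : Set V) := by
    intro σ τ hστ
    have hiff : (σ ∈ A) = (τ ∈ A) := hdA hστ
    by_cases hσ : σ ∈ A
    · rw [hF, Set.indicator_of_mem hσ, Set.indicator_of_mem (hiff.mp hσ), Pi.one_apply, Pi.one_apply]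
    · rw [hF, Set.indicator_of_notMem hσ, Set.indicator_of_notMem fun hτ => hσ (hiff.mpr hτ)]
  have hdF : DependsOn F (↑Λ : Set V) := hdFΔ.mono (Finset.coe_subset.2 hΔ)
  set h : (↥Λ → S) → ℝ := fun ζ => F (glueWith Λ ζ η) with hh
  have h01 : ∀ ζ, 0 ≤ h ζ ∧ h ζ ≤ 1 := fun ζ => by
    by_cases hm : glueWith Λ ζ η ∈ A
    · rw [hh, hF]; dsimp only; rw [Set.indicator_of_mem hm, Pi.one_apply]; norm_num
    · rw [hh, hF]; dsimp only; rw [Set.indicator_of_notMem hm]; norm_num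
  -- the two probabilities as finite sums
  have I₁ : μ₁.real A = ∑ ζ, ν₁ ζ * h ζ := by
    rw [← integral_indicator_one hA]; exact integral_eq_sum_fiber Λ η μ₁ hdF
  have I₂ : μ₂.real A = ∑ ζ, ν₂ ζ * h ζ := by
    rw [← integral_indicator_one hA, integral_eq_sum_fiber Λ η' μ₂ hdF]
    refine Finset.sum_congr rfl fun ζ _ => ?_
    congr 1
    exact hdF fun x hx => by
      rw [glueWith_apply_mem Λ ζ η' (Finset.mem_coe.1 hx), glueWith_apply_mem Λ ζ η (Finset.mem_coe.1 hx)]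
  -- … and as sums over pairs
  have S₁ : ∑ ζ, ν₁ ζ * h ζ = ∑ p : (↥Λ → S) × (↥Λ → S), ν₁ p.1 * ν₂ p.2 * h p.1 := by
    rw [Fintype.sum_prod_type]
    refine Finset.sum_congr rfl fun a _ => ?_
    dsimp only
    rw [← Finset.sum_mul, ← Finset.mul_sum, hν₂1, mul_one]
  have S₂ : ∑ ζ, ν₂ ζ * h ζ = ∑ p : (↥Λ → S) × (↥Λ → S), ν₁ p.1 * ν₂ p.2 * h p.2 := by
    rw [Fintype.sum_prod_type, Finset.sum_comm]
    refine Finset.sum_congr rfl fun b _ => ?_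
    dsimp only
    rw [← Finset.sum_mul, ← Finset.sum_mul, hν₁1, one_mul]
  -- the good event and the exchange map
  set E : Finset ((↥Λ → S) × (↥Λ → S)) := Finset.univ.filter fun p => ¬ Bad₂ G Λ Δ η η' p with hE
  have hmemE : ∀ p, p ∈ E ↔ ¬ Bad₂ G Λ Δ η η' p := fun p => by simp [hE]
  have hmemEc : ∀ p, p ∈ Eᶜ ↔ Bad₂ G Λ Δ η η' p := fun p => by simp [hE]
  have hmaps : ∀ p ∈ E, exch₂ G Λ Δ η η' p ∈ E := fun p hp => by
    rw [hmemE] at hp ⊢; rwa [bad₂_exch₂]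
  have hbij : Set.BijOn (exch₂ G Λ Δ η η') (E : Set _) (E : Set _) := by
    refine ⟨fun p hp => ?_, fun p _ q _ hpq => ?_, fun q hq => ?_⟩
    · exact Finset.mem_coe.2 (hmaps p (Finset.mem_coe.1 hp))
    · calc p = exch₂ G Λ Δ η η' (exch₂ G Λ Δ η η' p) := (exch₂_exch₂ p).symm
        _ = exch₂ G Λ Δ η η' (exch₂ G Λ Δ η η' q) := by rw [hpq]
        _ = q := exch₂_exch₂ q
    · exact ⟨exch₂ G Λ Δ η η' q, Finset.mem_coe.2 (hmaps q (Finset.mem_coe.1 hq)), exch₂_exch₂ q⟩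
  have hwT : ∀ p ∈ E, ν₁ (exch₂ G Λ Δ η η' p).1 * ν₂ (exch₂ G Λ Δ η η' p).2 = ν₁ p.1 * ν₂ p.2 := by
    intro p hp
    simp only [hν₁, hν₂, measureReal_def]
    rw [← ENNReal.toReal_mul, ← ENNReal.toReal_mul, weight_exch₂ hγ hM ((hmemE p).1 hp)]
  have hswap : ∀ p ∈ E, h (exch₂ G Λ Δ η η' p).2 = h p.1 := fun p _ =>
    hdFΔ fun x hx => by
      have hxΛ : x ∈ Λ := hΔ (Finset.mem_coe.1 hx)
      rw [glueWith_apply_mem Λ _ η hxΛ, glueWith_apply_mem Λ _ η hxΛ]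
      exact exch₂_snd_eq_fst_of_mem (Finset.mem_coe.1 hx) hxΛ
  have hgood : ∑ p ∈ E, ν₁ p.1 * ν₂ p.2 * h p.2 = ∑ p ∈ E, ν₁ p.1 * ν₂ p.2 * h p.1 :=
    sum_good_eq E ν₁ ν₂ h _ hbij hwT hswap
  -- the good parts cancel
  have hdiff : μ₁.real A - μ₂.real A = ∑ p ∈ Eᶜ, ν₁ p.1 * ν₂ p.2 * (h p.1 - h p.2) := by
    rw [I₁, I₂, S₁, S₂, ← Finset.sum_add_sum_compl E (fun p => ν₁ p.1 * ν₂ p.2 * h p.1),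
      ← Finset.sum_add_sum_compl E (fun p => ν₁ p.1 * ν₂ p.2 * h p.2), hgood]
    simp only [mul_sub, Finset.sum_sub_distrib]
    ring
  -- the bad part is at most the weight of the bad pairs
  have hbad : |∑ p ∈ Eᶜ, ν₁ p.1 * ν₂ p.2 * (h p.1 - h p.2)| ≤ ∑ p ∈ Eᶜ, ν₁ p.1 * ν₂ p.2 := by
    refine (Finset.abs_sum_le_sum_abs _ _).trans (Finset.sum_le_sum fun p _ => ?_)
    rw [abs_mul, abs_of_nonneg (mul_nonneg (hν₁0 p.1) (hν₂0 p.2))]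
    refine mul_le_of_le_one_right (mul_nonneg (hν₁0 p.1) (hν₂0 p.2)) ?_
    rw [abs_sub_le_iff]
    constructor <;> linarith [(h01 p.1).1, (h01 p.1).2, (h01 p.2).1, (h01 p.2).2]
  -- … which is at most the probability of the exit event
  rw [hdiff]
  exact hbad.trans (sum_bad_le_prod_real_exit hγ Eᶜ fun p hp => (hmemEc p).1 hp)

end TwoBoundaryConditions

end DisagreementCovariance

/-- **[GHM01] Corollary 7.11 — DISCHARGED** for the fact `GHM2001_disagreementCovarianceBound`:
covariances of local functions under a finite-volume kernel of a Markov specification with finite spin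
space are bounded by the total oscillations times the probability, for two INDEPENDENT copies, of a path
of disagreement inside `Λ` joining the supports.  Proof: van den Berg's exchange map on the disagreement
clusters meeting `Δ′` is a swapping map in the sense of Adhikari–Cao (tree
`AdhikariCao2022.IsSwappingMap`; weight invariance = consistency + Markov property,
`DisagreementCovariance.weight_exch`), and the tree's swapping lemma
`AdhikariCao2022.norm_fcov_le_of_isSwappingMap` gives the bound with the better constant
`δ(f)δ(g)/2`.  (The binders are exactly the parameters of the fact — graph, spin space, specification —
no hypotheses.) [cite: GeorgiiHaggstromMaes2001, Corollary 7.11] -/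
theorem GHM2001_disagreementCovarianceBound_holds {V : Type*} {S : Type*} [MeasurableSpace S]
    [MeasurableSingletonClass S] [Finite S] [DecidableEq V]
    {G : SimpleGraph V} [G.LocallyFinite] {γ : Specification V S} :
    GHM2001_disagreementCovarianceBound G γ := by
  intro hγ hM Λ Δ Δ' hΔ hΔ' _ η f g _ _ hdf hdg af bf ag bg hfb hgb
  exact DisagreementCovariance.covariance_bound hγ hM hΔ hΔ' f g hdf hdg hfb hgb

/-- **[GHM01] Proposition 7.10 — DISCHARGED** for the fact `GHM2001_productCouplingBound`: for a Markov
specification with finite spin space, `Δ ⊆ Λ` finite, boundary conditions `η, η′` and a `Δ`-local event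
`A`, `|γ_Λ(A | η) − γ_Λ(A | η′)| ≤ (γ_Λ^η ⊗ γ_Λ^{η′})(Δ ↔≠ ∂Λ)`.  Proof: van den Berg's exchange map on the
disagreement cluster of `Δ` (`DisagreementCovariance.exch₂`) is a weight-preserving involution of the good
event after which the second copy shows the first copy's `Δ`-spins (`weight_exch₂`,
`exch₂_snd_eq_fst_of_mem`), so the good parts cancel (`DisagreementCovariance.coupling_bound`).  (The
binders are exactly the parameters of the fact.) [cite: GeorgiiHaggstromMaes2001, Proposition 7.10] -/
theorem GHM2001_productCouplingBound_holds {V : Type*} {S : Type*} [MeasurableSpace S]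
    [MeasurableSingletonClass S] [Finite S] [DecidableEq V]
    {G : SimpleGraph V} [G.LocallyFinite] {γ : Specification V S} :
    GHM2001_productCouplingBound G γ := by
  intro hγ hM Λ Δ hΔ η η' A hA hdA
  exact DisagreementCovariance.coupling_bound hγ hM hΔ hA hdA

end Literature.Probability.LatticeModels

end
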